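import Literature.Probability.Percolation.CentralFiveArmIndex
import Literature.Probability.Percolation.PivotalFromSeparatedArms
import HarnessLib

/-!
# Centre spokes of the hexagon: disjoint lattice paths from the sides of `∂Λ_m` to the neighbours of the origin

Topic `Literature/Probability/Percolation`; family `crit-perc`. Deterministic lattice geometry
(definitions of explicit site sets and their elementary properties; no probability, no named
fact) for the INWARD EXTENSION of arms in the five-arm estimates: in P. Nolin, *Near-critical
percolation in two dimensions*, EJP 13 (2008), §4.1 [arXiv 0711.4948, p. 8] ("for any fixed
`n₁, n₂ ≥ n₀(j)`, `P̂(A_{j,σ}(n₁,N)) ≍ P̂(A_{j,σ}(n₂,N))`") and in H. Kesten, V. Sidoravicius,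
Y. Zhang, EJP 3 (1998), Lemma 5, (3.8) (the factor `k²` for arms issued from `Δ(v + S(k))`
instead of the neighbours of `v`), arms landing on the inner boundary `∂Λ_m` are continued inside
`Λ_m` down to the neighbours of the centre (at a finite-energy or RSW cost depending on `m` only).
The continuation used with Nolin's uniqueness lemma (`FiveArmUniqueness.lean`: arms from the
neighbours of `v`) must keep five arms pairwise disjoint; for arms landing on DISTINCT sides of
`∂Λ_m` (as the arm-separation theorem, Nolin Thm. 11, provides) this is achieved by the spokes
below, one per side, confined to six pairwise disjoint half-open sectors. (Unrelated to the
`spokeTube`/`spokeEvent` of `ArmSeparationSpoke.lean`, the RSW corridors leaving a fenced inner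
tip in the two-arm separation programme.)

* `raySector = {x₁ ≤ 0 < x₀ + x₁}` — the half-open sector of side `0` (the open cone `triCone`
  of `ArmSeparationFourArm.lean` together with the ray `{x₁ = 0, x₀ ≥ 1}`); its six rotated copies
  `ρ^a(raySector)` (`ρ = triRotIsoPow 1`, rotation by `60°`) are pairwise disjoint
  (`disjoint_image_rot_raySector`).
* `centreSpoke₀ m t` — the spoke of the landing site `z = (m, t)` of side `0` of `∂Λ_m`
  (`-m < t ≤ 0`, i.e. `z` is not the corner `(m, -m)` shared with side `5`): the diagonal
  `(m-1, t+1), (m-2, t+2), …, (m+t, 0)` followed by the axis `(m+t-1, 0), …, (1, 0)`; it lies in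
  `raySector ∩ {1 ≤ |·|_𝕋 ≤ m-1}`, its top `centreSpokeTop m t = (m-1, min(t+1, 0))` is a neighbour of
  `z`, its bottom `e₀ = (1, 0)` a neighbour of the origin, and every site of it is joined inside it
  to the top (`pathIn_centreSpoke₀`).
* `centreSpoke s m t = ρ^s(centreSpoke₀ m t)` — the spoke of the landing site `ρ^s(m, t)` of side `s`;
  `centreSpoke_spec` collects: sites of norm in `[1, m-1]`, bottom `ρ^s e₀ ∼ 0`, top `ρ^s(centreSpokeTop) ∼
  ρ^s(m, t)`, connectedness; `disjoint_centreSpoke` — spokes of distinct sides `a ≠ b < 6` are disjoint.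

## References

* P. Nolin, Near-critical percolation in two dimensions, *Electron. J. Probab.* 13 (2008)
  1562–1623, §4.1 (dependence on the inner radius), §4.2 (landing sequences on `∂S_n`)
  (arXiv 0711.4948, pp. 8–9) [Nolin2008].
* H. Kesten, V. Sidoravicius, Y. Zhang, Almost all words are seen in critical site percolation on
  the triangular lattice, *Electron. J. Probab.* 3 (1998), Lemma 5, (3.8) [KestenSidoraviciusZhang1998].

## Mathlib / tree

Tree: `pathIn_line` (`CentralFiveArmIndex.lean`), `triGraph_adj_add_triE0`,
`triGraph_adj_add_triDiag`, `triE0` (`TriHexLemma.lean`), `triDiag` (`TriangularLattice.lean`),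
`triRotIsoPow`, `add_zsmul_triE0_apply` (`TriAnnulusCircuit.lean`), `rot_apply_formula`,
`triNorm_rot` (`ArmSeparationRotate.lean`), `triRotIsoPow_apply_zero_site`
(`PivotalFromSeparatedArms.lean`), `pathIn_map_iso` (`TriRSWChaining.lean`), `triNorm_le_iff`
(`ArmEventsProofs.lean`), `abs_le_triNorm` (`OneArmLSW.lean`), `PathIn` (`SitePaths.lean`).
-/

noncomputable section

open Set

namespace Literature.Probability.Percolation

open LatticeModels

/-! ### The half-open sectors -/

/-- **The half-open sector of side `0`**: `{x₁ ≤ 0 < x₀ + x₁}` (the open cone over side `0` of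
the hexagons `∂Λ_N` together with its boundary ray `{x₁ = 0, x₀ ≥ 1}`). [folklore] -/
def raySector : Set (Site 2) := {v | v 1 ≤ 0 ∧ 0 < v 0 + v 1}

/-- Membership in the half-open sector, unfolded. [folklore] -/
@[simp] theorem mem_raySector {v : Site 2} : v ∈ raySector ↔ v 1 ≤ 0 ∧ 0 < v 0 + v 1 := Iff.rfl

/-- **The six rotated half-open sectors, by the signs of `x₀`, `x₁`, `x₀ + x₁`**: the `a`-th
one is `{x₁ ≤ 0 < x₀+x₁}`, `{0 ≤ x₀, 0 < x₁}`, `{x₀ < 0 ≤ x₀+x₁}`, `{0 ≤ x₁, x₀+x₁ < 0}`,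
`{x₀ ≤ 0, x₁ < 0}`, `{0 < x₀, x₀+x₁ ≤ 0}` for `a = 0, …, 5`. [folklore] -/
def raySectorRegion (a : ℕ) (w : Site 2) : Prop :=
  (a = 0 ∧ w 1 ≤ 0 ∧ 0 < w 0 + w 1) ∨ (a = 1 ∧ 0 ≤ w 0 ∧ 0 < w 1) ∨
    (a = 2 ∧ w 0 < 0 ∧ 0 ≤ w 0 + w 1) ∨ (a = 3 ∧ 0 ≤ w 1 ∧ w 0 + w 1 < 0) ∨
    (a = 4 ∧ w 0 ≤ 0 ∧ w 1 < 0) ∨ (a = 5 ∧ 0 < w 0 ∧ w 0 + w 1 ≤ 0)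

/-- `ρ^a` carries the half-open sector of side `0` into the `a`-th region (`rot_apply_formula`). [folklore] -/
theorem raySectorRegion_rot {a : ℕ} (ha : a < 6) {x : Site 2} (hx : x ∈ raySector) :
    raySectorRegion a (triRotIsoPow a x) := by
  obtain ⟨r00, r01, r10, r11, r20, r21, r30, r31, r40, r41, r50, r51⟩ := rot_apply_formula x
  obtain ⟨h1, h2⟩ := hx
  interval_cases a
  · exact Or.inl ⟨rfl, by rw [r01]; exact h1, by rw [r00, r01]; exact h2⟩
  · exact Or.inr (Or.inl ⟨rfl, by rw [r10]; omega, by rw [r11]; exact h2⟩)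
  · exact Or.inr (Or.inr (Or.inl ⟨rfl, by rw [r20]; omega, by rw [r20, r21]; omega⟩))
  · exact Or.inr (Or.inr (Or.inr (Or.inl ⟨rfl, by rw [r31]; omega, by rw [r30, r31]; omega⟩)))
  · exact Or.inr (Or.inr (Or.inr (Or.inr (Or.inl ⟨rfl, by rw [r40]; exact h1, by rw [r41]; omega⟩))))
  · exact Or.inr (Or.inr (Or.inr (Or.inr (Or.inr ⟨rfl, by rw [r50]; exact h2, by rw [r50, r51]; omega⟩))))

/-- The six regions are pairwise disjoint. [folklore] -/
theorem raySectorRegion_unique {a b : ℕ} {w : Site 2} (ha : raySectorRegion a w) (hb : raySectorRegion b w) :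
    a = b := by
  rcases ha with ⟨rfl, a1, a2⟩ | ⟨rfl, a1, a2⟩ | ⟨rfl, a1, a2⟩ | ⟨rfl, a1, a2⟩ | ⟨rfl, a1, a2⟩ |
    ⟨rfl, a1, a2⟩ <;>
  rcases hb with ⟨rfl, b1, b2⟩ | ⟨rfl, b1, b2⟩ | ⟨rfl, b1, b2⟩ | ⟨rfl, b1, b2⟩ | ⟨rfl, b1, b2⟩ |
    ⟨rfl, b1, b2⟩ <;>
  omega

/-- **The six rotated half-open sectors are pairwise disjoint.** [folklore] -/
theorem disjoint_image_rot_raySector {a b : ℕ} (ha : a < 6) (hb : b < 6) (hab : a ≠ b) :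
    Disjoint (triRotIsoPow a '' raySector) (triRotIsoPow b '' raySector) := by
  rw [Set.disjoint_left]
  rintro z ⟨x, hx, rfl⟩ ⟨y, hy, hxy⟩
  have hra := raySectorRegion_rot ha hx
  have hrb := raySectorRegion_rot hb hy
  rw [hxy] at hrb
  exact hab (raySectorRegion_unique hra hrb)

/-! ### The spoke of side `0` -/

/-- **The spoke of the landing site `(m, t)` of side `0`** (`-m < t ≤ 0`): the diagonal
`{x₀ + x₁ = m + t, t + 1 ≤ x₁ ≤ 0}` from `(m-1, t+1)` down to `(m+t, 0)`, and the axis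
`{x₁ = 0, 1 ≤ x₀ ≤ m + t - 1}` down to `e₀ = (1, 0)`. [folklore] -/
def centreSpoke₀ (m : ℕ) (t : ℤ) : Set (Site 2) :=
  {v | (v 0 + v 1 = m + t ∧ t + 1 ≤ v 1 ∧ v 1 ≤ 0) ∨ (v 1 = 0 ∧ 1 ≤ v 0 ∧ v 0 + 1 ≤ m + t)}

/-- Membership in the spoke of side `0`, unfolded. [folklore] -/
@[simp] theorem mem_centreSpoke₀ {m : ℕ} {t : ℤ} {v : Site 2} :
    v ∈ centreSpoke₀ m t ↔
      (v 0 + v 1 = m + t ∧ t + 1 ≤ v 1 ∧ v 1 ≤ 0) ∨ (v 1 = 0 ∧ 1 ≤ v 0 ∧ v 0 + 1 ≤ m + t) :=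
  Iff.rfl

/-- **The top of the spoke**: `(m-1, t+1)` if `t < 0`, `(m-1, 0)` if `t = 0` — the neighbour of
the landing site `(m, t)` inside `Λ_{m-1}`. [folklore] -/
def centreSpokeTop (m : ℕ) (t : ℤ) : Site 2 := ![(m : ℤ) - 1, min (t + 1) 0]

/-- Coordinates of the top. [folklore] -/
@[simp] theorem centreSpokeTop_apply_zero (m : ℕ) (t : ℤ) : centreSpokeTop m t 0 = (m : ℤ) - 1 := rfl

/-- Coordinates of the top. [folklore] -/
@[simp] theorem centreSpokeTop_apply_one (m : ℕ) (t : ℤ) : centreSpokeTop m t 1 = min (t + 1) 0 := rfl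

variable {m : ℕ} {t : ℤ}

/-- The spoke lies in the half-open sector of side `0`. [folklore] -/
theorem centreSpoke₀_subset_sector (ht : -(m : ℤ) < t) : centreSpoke₀ m t ⊆ raySector := by
  rintro v (⟨h1, h2, h3⟩ | ⟨h1, h2, h3⟩) <;> (rw [mem_raySector]; constructor <;> omega)

/-- **The spoke stays in `{1 ≤ |·|_𝕋 ≤ m - 1}`**: inside `Λ_{m-1}` and off the origin. [folklore] -/
theorem triNorm_of_mem_centreSpoke₀ (ht : -(m : ℤ) < t) (ht0 : t ≤ 0) {v : Site 2}
    (hv : v ∈ centreSpoke₀ m t) : 1 ≤ triNorm v ∧ triNorm v ≤ (m : ℤ) - 1 := by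
  obtain ⟨a0, -, a2⟩ := abs_le_triNorm v
  constructor
  · rcases hv with ⟨h1, h2, h3⟩ | ⟨h1, h2, h3⟩
    · have : (1 : ℤ) ≤ |v 0 + v 1| := by rw [abs_of_pos (by omega)]; omega
      exact this.trans a2
    · have : (1 : ℤ) ≤ |v 0| := by rw [abs_of_pos (by omega)]; exact h2
      exact this.trans a0
  · rw [triNorm_le_iff]
    rcases hv with ⟨h1, h2, h3⟩ | ⟨h1, h2, h3⟩ <;> refine ⟨?_, ?_, ?_⟩ <;> rw [abs_le] <;>
      constructor <;> omega

/-- The top lies on the spoke (`m ≥ 2`). [folklore] -/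
theorem centreSpokeTop_mem (hm : 2 ≤ m) (ht : -(m : ℤ) < t) (ht0 : t ≤ 0) : centreSpokeTop m t ∈ centreSpoke₀ m t := by
  rw [mem_centreSpoke₀, centreSpokeTop_apply_zero, centreSpokeTop_apply_one]
  rcases lt_or_eq_of_le ht0 with hlt | rfl
  · rw [min_eq_left (by omega : t + 1 ≤ 0)]
    exact Or.inl ⟨by omega, le_rfl, by omega⟩
  · rw [min_eq_right (by norm_num : (0 : ℤ) ≤ 0 + 1)]
    exact Or.inr ⟨rfl, by omega, by omega⟩

/-- **The top is a neighbour of the landing site** `(m, t)`. [folklore] -/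
theorem adj_centreSpokeTop (ht0 : t ≤ 0) : triGraph.Adj (![(m : ℤ), t] : Site 2) (centreSpokeTop m t) := by
  rcases lt_or_eq_of_le ht0 with hlt | rfl
  · have hmin : min (t + 1) 0 = t + 1 := min_eq_left (by omega)
    have h : centreSpokeTop m t + triDiag = ![(m : ℤ), t] := by
      ext i; fin_cases i <;> simp [centreSpokeTop, triDiag, hmin]
    have := triGraph_adj_add_triDiag (centreSpokeTop m t)
    rw [h] at this
    exact this.symm
  · have h : centreSpokeTop m 0 + triE0 = ![(m : ℤ), 0] := by
      ext i; fin_cases i <;> simp [centreSpokeTop]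
    have := triGraph_adj_add_triE0 (centreSpokeTop m 0)
    rw [h] at this
    exact this.symm

/-- **The bottom `e₀ = (1, 0)` lies on the spoke** (`m ≥ 2`). [folklore] -/
theorem triE0_mem_centreSpoke₀ (hm : 2 ≤ m) (ht : -(m : ℤ) < t) : triE0 ∈ centreSpoke₀ m t := by
  rw [mem_centreSpoke₀, triE0_apply_zero, triE0_apply_one]
  by_cases h2 : (2 : ℤ) ≤ m + t
  · exact Or.inr ⟨rfl, le_rfl, by omega⟩
  · exact Or.inl ⟨by omega, by omega, le_rfl⟩

/-- The bottom is a neighbour of the origin. [folklore] -/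
theorem adj_triE0_zero : triGraph.Adj triE0 (0 : Site 2) := by
  have := triGraph_adj_add_triE0 (0 : Site 2)
  rw [zero_add] at this
  exact this.symm

/-- Coordinates along a ray in direction `(1, -1)`. [folklore] -/
theorem ray_triDiag_apply (x : Site 2) (j : ℤ) :
    (x + j • triDiag) 0 = x 0 + j ∧ (x + j • triDiag) 1 = x 1 - j := by
  constructor <;> simp [triDiag, sub_eq_add_neg]

/-- **Up the diagonal**: a site of the diagonal part is joined inside the spoke to the top. [folklore] -/
theorem pathIn_centreSpoke₀_of_diag {v : Site 2} (h1 : v 0 + v 1 = m + t) (h2 : t + 1 ≤ v 1) (h3 : v 1 ≤ 0) :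
    PathIn triGraph (centreSpoke₀ m t) v (centreSpokeTop m t) := by
  have hmin : min (t + 1) 0 = t + 1 := min_eq_left (by omega)
  set k : ℕ := (v 1 - (t + 1)).toNat with hk
  have hkz : (k : ℤ) = v 1 - (t + 1) := Int.toNat_of_nonneg (by omega)
  have hP := pathIn_line (S := centreSpoke₀ m t) triGraph_adj_add_triDiag v k fun j hj => by
    have hjk : (j : ℤ) ≤ k := by exact_mod_cast hj
    obtain ⟨e0, e1⟩ := ray_triDiag_apply v j
    left
    rw [e0, e1]
    omega
  have hend : v + (k : ℤ) • triDiag = centreSpokeTop m t := by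
    obtain ⟨e0, e1⟩ := ray_triDiag_apply v k
    ext i; fin_cases i
    · simp only [Fin.zero_eta, centreSpokeTop_apply_zero]; rw [e0]; omega
    · simp only [Fin.mk_one, centreSpokeTop_apply_one, hmin]; rw [e1]; omega
  rwa [hend] at hP

/-- **Every site of the spoke is joined inside the spoke to the top** (`m ≥ 2`, `-m < t ≤ 0`):
along the axis to `(m+t-1, 0)`, one step to the foot `(m+t, 0)` of the diagonal, then up the
diagonal. [folklore] -/
theorem pathIn_centreSpoke₀ (ht0 : t ≤ 0) {v : Site 2} (hv : v ∈ centreSpoke₀ m t) :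
    PathIn triGraph (centreSpoke₀ m t) v (centreSpokeTop m t) := by
  rcases hv with ⟨h1, h2, h3⟩ | ⟨h1, h2, h3⟩
  · exact pathIn_centreSpoke₀_of_diag h1 h2 h3
  · -- along the axis to `(m + t - 1, 0)`
    set k : ℕ := ((m : ℤ) + t - 1 - v 0).toNat with hk
    have hkz : (k : ℤ) = (m : ℤ) + t - 1 - v 0 := Int.toNat_of_nonneg (by omega)
    have hP := pathIn_line (S := centreSpoke₀ m t) triGraph_adj_add_triE0 v k fun j hj => by
      have hjk : (j : ℤ) ≤ k := by exact_mod_cast hj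
      obtain ⟨e0, e1⟩ := add_zsmul_triE0_apply v j
      right
      rw [e0, e1]
      omega
    obtain ⟨e0, e1⟩ := add_zsmul_triE0_apply v k
    rcases lt_or_eq_of_le ht0 with hlt | rfl
    · -- one more step to the foot of the diagonal, then up
      have hfoot1 : (v + (k : ℤ) • triE0 + triE0) 0 + (v + (k : ℤ) • triE0 + triE0) 1 = m + t := by
        simp only [Pi.add_apply, triE0_apply_zero, triE0_apply_one] at e0 e1 ⊢
        omega
      have hfoot2 : t + 1 ≤ (v + (k : ℤ) • triE0 + triE0) 1 := by
        simp only [Pi.add_apply, triE0_apply_one] at e1 ⊢; omega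
      have hfoot3 : (v + (k : ℤ) • triE0 + triE0) 1 ≤ 0 := by
        simp only [Pi.add_apply, triE0_apply_one] at e1 ⊢; omega
      exact (hP.tail (triGraph_adj_add_triE0 _) (Or.inl ⟨hfoot1, hfoot2, hfoot3⟩)).trans
        (pathIn_centreSpoke₀_of_diag hfoot1 hfoot2 hfoot3)
    · have hend : v + (k : ℤ) • triE0 = centreSpokeTop m 0 := by
        ext i; fin_cases i
        · simp only [Fin.zero_eta, centreSpokeTop_apply_zero]; rw [e0]; omega
        · simp only [Fin.mk_one, centreSpokeTop_apply_one, zero_add, min_eq_right (zero_le_one' ℤ)]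
          rw [e1]; omega
      rwa [hend] at hP

/-! ### The spokes of the six sides -/

/-- **The spoke of the landing site `ρ^s(m, t)` of side `s`** of `∂Λ_m`: the image of the spoke
of side `0` under the rotation `ρ^s`. [folklore] -/
def centreSpoke (s m : ℕ) (t : ℤ) : Set (Site 2) := triRotIsoPow s '' centreSpoke₀ m t

/-- A spoke lies in the rotated half-open sector of its side. [folklore] -/
theorem centreSpoke_subset_sector {s : ℕ} (ht : -(m : ℤ) < t) :
    centreSpoke s m t ⊆ triRotIsoPow s '' raySector :=
  image_mono (centreSpoke₀_subset_sector ht)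

/-- **Spokes of distinct sides are disjoint.** [folklore] -/
theorem disjoint_centreSpoke {a b : ℕ} (ha : a < 6) (hb : b < 6) (hab : a ≠ b) {m m' : ℕ} {t t' : ℤ}
    (ht : -(m : ℤ) < t) (ht' : -(m' : ℤ) < t') : Disjoint (centreSpoke a m t) (centreSpoke b m' t') :=
  (disjoint_image_rot_raySector ha hb hab).mono (centreSpoke_subset_sector ht) (centreSpoke_subset_sector ht')

/-- A spoke stays in `{1 ≤ |·|_𝕋 ≤ m - 1}`. [folklore] -/
theorem triNorm_of_mem_centreSpoke {s : ℕ} (ht : -(m : ℤ) < t) (ht0 : t ≤ 0) {v : Site 2}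
    (hv : v ∈ centreSpoke s m t) : 1 ≤ triNorm v ∧ triNorm v ≤ (m : ℤ) - 1 := by
  obtain ⟨x, hx, rfl⟩ := hv
  rw [triNorm_rot]
  exact triNorm_of_mem_centreSpoke₀ ht ht0 hx

/-- The origin is not on a spoke. [folklore] -/
theorem origin_not_mem_centreSpoke {s : ℕ} (ht : -(m : ℤ) < t) (ht0 : t ≤ 0) : (0 : Site 2) ∉ centreSpoke s m t :=
    fun h => by
  have := (triNorm_of_mem_centreSpoke ht ht0 h).1
  rw [triNorm_zero] at this
  exact absurd this (by norm_num)

/-- Every site of a spoke is joined inside it to its top `ρ^s(centreSpokeTop m t)`. [folklore] -/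
theorem pathIn_centreSpoke {s : ℕ} (ht0 : t ≤ 0) {v : Site 2} (hv : v ∈ centreSpoke s m t) :
    PathIn triGraph (centreSpoke s m t) v (triRotIsoPow s (centreSpokeTop m t)) := by
  obtain ⟨x, hx, rfl⟩ := hv
  exact pathIn_map_iso (triRotIsoPow s) (pathIn_centreSpoke₀ ht0 hx)

/-- **The spoke of side `s`, summarised** (`m ≥ 2`, `-m < t ≤ 0`): it lies in
`{1 ≤ |·|_𝕋 ≤ m - 1}`; its bottom `ρ^s e₀` lies on it and is a neighbour of the origin; its top
`ρ^s(centreSpokeTop m t)` lies on it and is a neighbour of the landing site `ρ^s(m, t) ∈ ∂Λ_m`; every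
site of it is joined inside it to the top. Together with `disjoint_centreSpoke`: five arms landing on
five distinct sides of `∂Λ_m` (off the far corners) extend, inside `Λ_{m-1} ∖ {0}` and pairwise
disjointly, to the neighbours of the origin. [cite: Nolin2008, §4.1 (arXiv 0711.4948, p. 8: arms from a fixed inner radius)] [cite: KestenSidoraviciusZhang1998, Lemma 5, (3.8)] -/
theorem centreSpoke_spec {s : ℕ} (hm : 2 ≤ m) (ht : -(m : ℤ) < t) (ht0 : t ≤ 0) :
    centreSpoke s m t ⊆ {v | 1 ≤ triNorm v ∧ triNorm v ≤ (m : ℤ) - 1} ∧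
      triRotIsoPow s triE0 ∈ centreSpoke s m t ∧ triGraph.Adj (triRotIsoPow s triE0) 0 ∧
      triRotIsoPow s (centreSpokeTop m t) ∈ centreSpoke s m t ∧
      triGraph.Adj (triRotIsoPow s ![(m : ℤ), t]) (triRotIsoPow s (centreSpokeTop m t)) ∧
      ∀ v ∈ centreSpoke s m t, PathIn triGraph (centreSpoke s m t) v (triRotIsoPow s (centreSpokeTop m t)) := by
  refine ⟨fun v hv => triNorm_of_mem_centreSpoke ht ht0 hv, mem_image_of_mem _ (triE0_mem_centreSpoke₀ hm ht),
    ?_, mem_image_of_mem _ (centreSpokeTop_mem hm ht ht0), (triRotIsoPow s).map_adj_iff.2 (adj_centreSpokeTop ht0),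
    fun v hv => pathIn_centreSpoke ht0 hv⟩
  have h := (triRotIsoPow s).map_adj_iff.2 adj_triE0_zero
  rwa [triRotIsoPow_apply_zero_site] at h

/-- The landing site `ρ^s(m, t)` lies on `∂Λ_m` (`-m ≤ t ≤ 0`). [folklore] -/
theorem triNorm_rot_landing (s : ℕ) (ht : -(m : ℤ) ≤ t) (ht0 : t ≤ 0) :
    triNorm (triRotIsoPow s ![(m : ℤ), t]) = m := by
  rw [triNorm_rot]
  apply le_antisymm
  · rw [triNorm_le_iff]
    simp only [Matrix.cons_val_zero, Matrix.cons_val_one, Matrix.cons_val_fin_one]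
    refine ⟨?_, ?_, ?_⟩ <;> rw [abs_le] <;> constructor <;> omega
  · obtain ⟨a0, -, -⟩ := abs_le_triNorm (![(m : ℤ), t] : Site 2)
    simp only [Matrix.cons_val_zero] at a0
    rw [abs_of_nonneg (by omega)] at a0
    exact a0

end Literature.Probability.Percolation
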